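import Mathlib.RepresentationTheory.Homological.GroupHomology.Functoriality
import Mathlib.RepresentationTheory.Homological.GroupHomology.LowDegree
import Mathlib.GroupTheory.GroupAction.Defs
import HarnessLib

/-!
# `H₁` of a group with coefficients in a permutation module `k[X]`: the component maps
# `H₁(Γ_x, k) → H₁(Γ, k[X])` and the stabilizer symbols `[γ ⊗ aδ_x]` (Brown, *Cohomology of Groups*, III §5–§6)

Topic `Literature/Algebra/Homology`; namespace `Literature.Algebra.Homology.PermutationCoeff`.
Definitions WITH bodies and proved theorems; no named fact, no `sorry`, no instance, no notation.
First of three files: this one sets up the objects; `GroupHomologyPermutationModuleGenerators` proves that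
the stabilizer symbols generate `H₁(Γ, k[X])` (explicit degree-one transfer); `GroupHomologyPermutationModuleShapiro`
proves the degree-one Shapiro isomorphism `H₁(Γ_{x₀}, k) ≃ H₁(Γ, k[X])` for a transitive `X`.

## Setting and contents

`k` a commutative ring, `Γ`, `S` groups, `φ : Γ →* S`, `X` an `S`-set — so `Γ` acts on `X` THROUGH `φ`
(a homomorphism instead of a `MulAction Γ X` instance lets consumers act through reduction maps such as
`Γ₀(M) → GL₂(ℤ/p)` without declaring instances).

* `permRep k φ X : Representation k Γ (X →₀ k)`, `γ · aδ_x = aδ_{φ(γ)x}` — the **permutation representation**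
  `k[X]` (Brown III §5: `ℤ[G/H] ≅ Ind_H^G ℤ`); `permRepObj k φ X : Rep k Γ`.  (Mathlib's
  `Representation.ofMulAction` is valued in `MonoidAlgebra`, now a structure; the chain-level computations of
  the sequels need honest finitely supported functions, hence the two-line re-definition.)
* `stabilizerIn φ x = φ⁻¹(Stab_S x) ≤ Γ`; `toPermHom k φ x : k_triv ⟶ Res_{Γ_x} k[X]`, `a ↦ aδ_x`;
  the **component map** `componentMap k φ x : H₁(Γ_x, k) → H₁(Γ, k[X])`
  (`= groupHomology.map Γ_x.subtype (toPermHom k φ x) 1`, Mathlib functoriality);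
* the **stabilizer symbol** `stabSymbol k φ x γ a = [γ ⊗ aδ_x] ∈ H₁(Γ, k[X])` for `γ ∈ Γ_x` (the `1`-chain
  `γ ⊗ aδ_x` is a cycle exactly because `γ` fixes `x`, `single_single_mem_cycles₁`), and
  `componentMap_H1π_single`: the component map sends Mathlib's generator `[γ ⊗ a]` of `H₁(Γ_x, k)` to it.

Homology is Mathlib's `groupHomology.H1` (inhomogeneous chains: `C₁ = Γ →₀ A`, `d(g ⊗ a) = g⁻¹a − a`,
`d((g, h) ⊗ a) = h ⊗ g⁻¹a − gh ⊗ a + g ⊗ a`).  All chain-level statements are typed with the coerced carrier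
`Γ →₀ permRepObj k φ X`, as Mathlib's own low-degree lemmas are.

Consumer (motivation; not imported): the full-level modular-curve carrier
`H₁(Y(K(p)K₀(M)), k) = H₁(Γ₀(M), k[GL₂(ℤ/p)])` (route BSD/TeichmullerTwistDescent, crux
`TwistedPeriodLatticeSaturation`, step (S2) of the composed K-line: torus-invariants `= H₁(Γ₀(M), k[G/T̃]) ≅ H₁(Γ_T, k)`).

## References
* K. S. Brown, *Cohomology of Groups*, GTM 87 (1982), Ch. III §5 (induced and co-induced modules, `ℤ[G/H]`),
  §6 (Shapiro's lemma, Prop. 6.2; (6.3)–(6.5)). [Brown1982]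
* A. Ash, G. Stevens, *Modular forms in characteristic ℓ and special values of their L-functions*, Duke Math. J.
  53 (1986), §1 (homology of congruence subgroups with coefficient modules). [AshStevens1986]
-/

noncomputable section

open CategoryTheory groupHomology Finsupp

universe u

namespace Literature.Algebra.Homology

namespace PermutationCoeff

variable (k : Type u) [CommRing k] {Γ S : Type u} [Group Γ] [Group S] (φ : Γ →* S)
  (X : Type u) [MulAction S X]

/-! ### The permutation representation `k[X]` of `Γ` (acting through `φ : Γ →* S`, `S ↷ X`) -/

/-- The permutation representation of `Γ` on `X →₀ k`: `γ · δ_x = δ_{φ(γ) • x}`. [cite: Brown1982, Ch. III §5 (permutation modules `ℤ[G/H]`)] -/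
def permRep : Representation k Γ (X →₀ k) where
  toFun γ := Finsupp.lmapDomain k k (φ γ • ·)
  map_one' := by
    simp only [map_one, one_smul]
    exact Finsupp.lmapDomain_id k k
  map_mul' γ δ := by
    rw [Module.End.mul_eq_comp, ← Finsupp.lmapDomain_comp]
    congr 1
    ext x : 1
    simp [mul_smul]

variable {k X}

/-- Unfolding `permRep`: `γ · f = mapDomain (φ(γ) • ·) f`. [cite: Brown1982, Ch. III §5 (permutation modules)] -/
theorem permRep_apply (γ : Γ) (f : X →₀ k) : permRep k φ X γ f = mapDomain (φ γ • ·) f := rfl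

/-- `γ · aδ_x = aδ_{φ(γ)x}`. [cite: Brown1982, Ch. III §5 (permutation modules)] -/
@[simp] theorem permRep_single (γ : Γ) (x : X) (a : k) :
    permRep k φ X γ (single x a) = single (φ γ • x) a := by
  rw [permRep_apply, mapDomain_single]

variable (k X) in
/-- The permutation representation as an object of `Rep k Γ`. [folklore] -/
abbrev permRepObj : Rep k Γ := Rep.of (permRep k φ X)

/-- The representation underlying `permRepObj` is `permRep`. [cite: Brown1982, Ch. III §5] -/
theorem permRepObj_ρ : (permRepObj k φ X).ρ = permRep k φ X := rfl

/-- The stabilizer of `x ∈ X` in `Γ` (acting through `φ`). [folklore] -/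
def stabilizerIn (x : X) : Subgroup Γ := (MulAction.stabilizer S x).comap φ

/-- `γ ∈ Γ_x ↔ φ(γ)x = x`. [cite: Brown1982, Ch. III §5] -/
theorem mem_stabilizerIn_iff {x : X} {γ : Γ} : γ ∈ stabilizerIn φ x ↔ φ γ • x = x := Iff.rfl

/-- `γ ∈ Γ_x ⇒ φ(γ)⁻¹x = x`. [cite: Brown1982, Ch. III §5] -/
theorem inv_smul_eq_of_mem_stabilizerIn {x : X} {γ : Γ} (h : γ ∈ stabilizerIn φ x) :
    φ γ⁻¹ • x = x := by
  rw [map_inv, inv_smul_eq_iff]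
  exact h.symm

/-! ### The component map `H₁(Γ_x, k) → H₁(Γ, k[X])` and the stabilizer symbols -/

section Component

variable (k) (x : X)

/-- `a ↦ a · δ_x`, a morphism from the trivial representation of the stabilizer `Γ_x` to the restriction
of `k[X]`. [cite: Brown1982, Ch. III §6 (6.3)] -/
def toPermHom : Rep.trivial k (stabilizerIn φ x) k ⟶
    Rep.res (stabilizerIn φ x).subtype (permRepObj k φ X) :=
  Rep.ofHom ((Finsupp.lsingle x : k →ₗ[k] (X →₀ k)).intertwiningMap_of_isIntertwiningMap _ _
    (fun γ a => by
      change single x a = permRep k φ X γ.1 (single x a)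
      rw [permRep_single, (mem_stabilizerIn_iff φ).1 γ.2]))

/-- `toPermHom` is `a ↦ aδ_x`. [cite: Brown1982, Ch. III §6 (6.3)] -/
@[simp] theorem toPermHom_apply (a : k) : (toPermHom k φ x).hom a = single x a := rfl

/-- **The component map** `ι_x : H₁(Γ_x, k) → H₁(Γ, k[X])` induced by the inclusion `Γ_x ≤ Γ` and
`a ↦ a δ_x`. [cite: Brown1982, Ch. III §6 Prop. 6.2 and (6.3)] -/
def componentMap : H1 (Rep.trivial k (stabilizerIn φ x) k) ⟶ H1 (permRepObj k φ X) :=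
  groupHomology.map (stabilizerIn φ x).subtype (toPermHom k φ x) 1

/-- The `1`-chain `γ ⊗ a δ_x` is a cycle when `γ` stabilizes `x`. [cite: Brown1982, Ch. III §6 (6.3)] -/
theorem single_single_mem_cycles₁ {γ : Γ} (hγ : γ ∈ stabilizerIn φ x) (a : k) :
    single γ (single x a) ∈ cycles₁ (permRepObj k φ X) := by
  rw [single_mem_cycles₁_iff]
  show permRep k φ X γ (single x a) = single x a
  rw [permRep_single, (mem_stabilizerIn_iff φ).1 hγ]

/-- **Stabilizer symbol**: the class `[γ ⊗ a δ_x] ∈ H₁(Γ, k[X])` for `γ ∈ Γ_x`. [cite: Brown1982, Ch. III §6 (6.3)–(6.5)] -/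
def stabSymbol (γ : stabilizerIn φ x) (a : k) : H1 (permRepObj k φ X) :=
  H1π _ ⟨single γ.1 (single x a), single_single_mem_cycles₁ k φ x γ.2 a⟩

/-- The component map on the generator `[γ ⊗ a]` of `H₁(Γ_x, k)` is the stabilizer symbol `[γ ⊗ a δ_x]`. [cite: Brown1982, Ch. III §6 (6.3)–(6.4)] -/
theorem componentMap_H1π_single (γ : stabilizerIn φ x) (a : k) :
    componentMap k φ x (H1π _ ((cycles₁IsoOfIsTrivial _).inv (single γ a))) = stabSymbol k φ x γ a := by
  rw [componentMap]
  rw [groupHomology.H1π_comp_map_apply (A := Rep.trivial k (stabilizerIn φ x) k)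
    (B := permRepObj k φ X) (stabilizerIn φ x).subtype (toPermHom k φ x)]
  unfold stabSymbol
  congr 1
  apply Subtype.ext
  rw [coe_mapCycles₁, cycles₁IsoOfIsTrivial_inv_apply]
  simp only [ModuleCat.hom_ofHom, LinearMap.coe_comp, Function.comp_apply, lmapDomain_apply,
    mapDomain_single, mapRange.linearMap_apply, mapRange_single, Subgroup.coe_subtype]
  rfl

end Component

end PermutationCoeff

end Literature.Algebra.Homology
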